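import Mathlib.Analysis.SpecialFunctions.Pow.Real
import Mathlib.Analysis.SpecialFunctions.Sqrt
import Mathlib.Algebra.Order.Chebyshev
import Mathlib.Algebra.BigOperators.Field
import Mathlib.Data.Fintype.BigOperators
import HarnessLib

/-!
# The Leftover Hash Lemma (collision-probability form, flat sources)

Trunk `CryptoQuantFine` / `CplxCore`. The quantitative core of the Leftover Hash Lemma
(Impagliazzo–Levin–Luby 1989; Håstad–Impagliazzo–Levin–Luby 1999), in the form used by
Arora–Barak 2009, Lemma 21.26 and its proof (p. 522): the statistical distance of a distribution
from the uniform distribution on a finite set `T` is controlled by its **collision probability**,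

  `Δ(g(U_S), U_T) ≤ ½ · √(|T| · CP(g(U_S)) − 1)`     (`distUnif_le_sqrt`),

where `CP(Z) = Pr[Z = Z']` for two independent copies (`collProb`; for `Z = g(U_S)` it is the
number of colliding pairs `(x, x') ∈ S²` over `|S|²`, `collProb_eq_sum_sq`: `CP = Σ_v Pr[Z = v]²`).
The proof is the printed one: write the probability vector as uniform plus an orthogonal part and
use Cauchy–Schwarz (`(Σ_v |p_v − 1/|T||)² ≤ |T| Σ_v (p_v − 1/|T|)² = |T|·CP − 1`).

Consequence, the **Leftover Hash Lemma for flat sources** (`leftoverHash_flat`): for a pairwise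
independent family `(h_k)_{k ∈ K}` from `α` to a finite set of size `|B|` (`IsPairwiseIndep`:
for `x ≠ x'` the pair `(h_k x, h_k x')` is uniform over `k`) and `X` uniform on a set `S`,
`Δ((K, h_K(X)), (K, U_B)) ≤ ½ √(|B| / |S|)`; with `|S| ≥ 2ᵏ` and `|B| = 2^{k-d}` this is the printed
`≤ 2^{-d/2}` (`leftoverHash_flat_two_pow`). General min-entropy-`k` sources (the printed
hypothesis `H_∞(X) ≥ k`; every `(n,k)`-source is a convex combination of flat ones, AB p. 521)
are not treated here; flat sources are what the tree's consumers (Liu–Pass 2020, Lemma 5.3,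
`LiuPassCondFromRegular.lean`) need.

All statements are proved (Mathlib only). Distances are the finite sums `distUnif`; the bridge to
`PMF.tvDist` of the tree's `StatisticalDistance.lean` is left to consumers (cf.
`tvDist_condUniform_map_eq_sdUnif`, `LiuPassCondFromRegular.lean`).

## References

* S. Arora, B. Barak, *Computational Complexity: A Modern Approach*, CUP 2009, Lemma 21.26
  (Leftover hash lemma [BBR88, ILL89]) and its proof (collision probability, p. 522); §8.2.2
  (pairwise independent hash functions).
* J. Håstad, R. Impagliazzo, L. A. Levin, M. Luby, *A pseudorandom generator from any one-way
  function*, SIAM J. Comput. 28 (1999) 1364–1396 (Leftover Hash Lemma).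
* Y. Liu, R. Pass, *On one-way functions and Kolmogorov complexity*, FOCS 2020
  (arXiv:2009.11514), Appendix, "The Leftover Hash Lemma" (the form `SD ≤ 2^{-d/2}`).
-/

namespace Literature.Computability.Cryptography

open Finset

namespace LeftoverHash

variable {ι β κ : Type*} [DecidableEq β]

/-! ### Fibres, collision probability, distance from uniform -/

/-- The fibre of `g` over `v` inside `S`. [folklore] -/
def fib (S : Finset ι) (g : ι → β) (v : β) : Finset ι := S.filter fun x => g x = v

/-- `Pr[g(U_S) = v] = |fibre| / |S|`. [folklore] -/
noncomputable def prob (S : Finset ι) (g : ι → β) (v : β) : ℝ := ((fib S g v).card : ℝ) / S.card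

/-- **Collision probability** of `g(U_S)`: the fraction of pairs `(x, x') ∈ S × S` with
`g x = g x'`. [Arora–Barak 2009, proof of Lemma 21.26 ("collision probability")]
[cite: AroraBarak2009, Lemma 21.26 (proof)] -/
noncomputable def collProb (S : Finset ι) (g : ι → β) : ℝ :=
  (((S ×ˢ S).filter fun p => g p.1 = g p.2).card : ℝ) / ((S.card : ℝ) ^ 2)

/-- **Distance from uniform** of `g(U_S)` to the uniform distribution on `T` (for `g(S) ⊆ T`):
`½ Σ_{v ∈ T} |Pr[g(U_S) = v] − 1/|T||`. [Arora–Barak 2009, §21.5.2 and §A.2.6 (statistical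
distance), Lemma 21.26] [cite: AroraBarak2009, §21.5.2] -/
noncomputable def distUnif (S : Finset ι) (g : ι → β) (T : Finset β) : ℝ :=
  2⁻¹ * ∑ v ∈ T, |prob S g v - 1 / T.card|

omit [DecidableEq β] in
/-- Membership in a fibre. [folklore] -/
@[simp] theorem mem_fib [DecidableEq β] {S : Finset ι} {g : ι → β} {v : β} {x : ι} :
    x ∈ fib S g v ↔ x ∈ S ∧ g x = v := Finset.mem_filter

/-- `prob ≥ 0`. [folklore] -/
theorem prob_nonneg (S : Finset ι) (g : ι → β) (v : β) : 0 ≤ prob S g v := by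
  unfold prob; positivity

/-- The fibres over `T ⊇ g(S)` partition `S`: `Σ_{v ∈ T} |fib v| = |S|`. [folklore] -/
theorem sum_card_fib {S : Finset ι} {g : ι → β} {T : Finset β} (hT : ∀ x ∈ S, g x ∈ T) :
    ∑ v ∈ T, (fib S g v).card = S.card := by
  unfold fib
  exact (Finset.card_eq_sum_card_fiberwise hT).symm

/-- `Σ_{v ∈ T} Pr[g(U_S) = v] = 1` for `g(S) ⊆ T`, `S ≠ ∅`. [folklore] -/
theorem sum_prob {S : Finset ι} (hS : S.Nonempty) {g : ι → β} {T : Finset β} (hT : ∀ x ∈ S, g x ∈ T) :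
    ∑ v ∈ T, prob S g v = 1 := by
  have hc : (0 : ℝ) < S.card := by exact_mod_cast hS.card_pos
  unfold prob
  rw [← Finset.sum_div, ← Nat.cast_sum, sum_card_fib hT, div_self hc.ne']

/-- The colliding pairs, fibrewise: `#{(x,x') ∈ S² : g x = g x'} = Σ_{v ∈ T} |fib v|²` for
`g(S) ⊆ T`. [Arora–Barak 2009, proof of Lemma 21.26] [cite: AroraBarak2009, Lemma 21.26 (proof)] -/
theorem card_collisions_eq_sum_sq {S : Finset ι} {g : ι → β} {T : Finset β} (hT : ∀ x ∈ S, g x ∈ T) :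
    ((S ×ˢ S).filter fun p => g p.1 = g p.2).card = ∑ v ∈ T, (fib S g v).card ^ 2 := by
  classical
  rw [Finset.card_eq_sum_card_fiberwise (f := fun p : ι × ι => g p.1) (t := T)
    (fun p hp => hT p.1 (Finset.mem_product.1 (Finset.mem_filter.1 hp).1).1)]
  refine Finset.sum_congr rfl fun v _ => ?_
  have h : ((S ×ˢ S).filter fun p : ι × ι => g p.1 = g p.2).filter (fun p => g p.1 = v) = fib S g v ×ˢ fib S g v := by
    ext ⟨x, x'⟩
    simp only [Finset.mem_filter, Finset.mem_product, mem_fib]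
    constructor
    · rintro ⟨⟨⟨hx, hx'⟩, hg⟩, hv⟩; exact ⟨⟨hx, hv⟩, hx', hg ▸ hv⟩
    · rintro ⟨⟨hx, hv⟩, hx', hv'⟩; exact ⟨⟨⟨hx, hx'⟩, hv.trans hv'.symm⟩, hv⟩
  rw [h, Finset.card_product, sq]

/-- **`CP = Σ_v Pr[Z = v]²`** for `Z = g(U_S)`, `g(S) ⊆ T`, `S ≠ ∅`. [Arora–Barak 2009, proof of
Lemma 21.26] [cite: AroraBarak2009, Lemma 21.26 (proof)] -/
theorem collProb_eq_sum_sq {S : Finset ι} (hS : S.Nonempty) {g : ι → β} {T : Finset β} (hT : ∀ x ∈ S, g x ∈ T) :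
    collProb S g = ∑ v ∈ T, prob S g v ^ 2 := by
  have hc : (0 : ℝ) < S.card := by exact_mod_cast hS.card_pos
  unfold collProb prob
  rw [card_collisions_eq_sum_sq hT, Nat.cast_sum]
  rw [Finset.sum_div]
  refine Finset.sum_congr rfl fun v _ => ?_
  rw [Nat.cast_pow, div_pow]

/-- `CP ≥ 0`. [folklore] -/
theorem collProb_nonneg (S : Finset ι) (g : ι → β) : 0 ≤ collProb S g := by
  unfold collProb; positivity

/-- `distUnif ≥ 0`. [folklore] -/
theorem distUnif_nonneg (S : Finset ι) (g : ι → β) (T : Finset β) : 0 ≤ distUnif S g T := by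
  unfold distUnif; positivity

/-! ### The collision-probability bound on the distance from uniform -/

/-- **Distance from uniform via collision probability** (the core of the Leftover Hash Lemma):
for `S ≠ ∅`, `T ≠ ∅` and `g(S) ⊆ T`,
`Δ(g(U_S), U_T) ≤ ½ √(|T| · CP(g(U_S)) − 1)`.
Proof as printed: Cauchy–Schwarz, `(Σ_v |p_v − u|)² ≤ |T| Σ_v (p_v − u)² = |T| Σ p_v² − 1` with
`u = 1/|T|`, `Σ p_v = 1`. [Arora–Barak 2009, Lemma 21.26 (proof, p. 522)]
[cite: AroraBarak2009, Lemma 21.26 (proof)] -/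
theorem distUnif_le_sqrt {S : Finset ι} (hS : S.Nonempty) {g : ι → β} {T : Finset β} (hTne : T.Nonempty)
    (hT : ∀ x ∈ S, g x ∈ T) :
    distUnif S g T ≤ 2⁻¹ * Real.sqrt (T.card * collProb S g - 1) := by
  have hN : (0 : ℝ) < T.card := by exact_mod_cast hTne.card_pos
  set u : ℝ := 1 / T.card with hu
  set p : β → ℝ := prob S g with hp
  -- Cauchy–Schwarz with the constant vector `1`
  have hCS : (∑ v ∈ T, |p v - u|) ^ 2 ≤ T.card * ∑ v ∈ T, (p v - u) ^ 2 := by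
    have h := Finset.sum_mul_sq_le_sq_mul_sq T (fun v => |p v - u|) (fun _ => (1 : ℝ))
    simp only [mul_one, one_pow, Finset.sum_const, nsmul_eq_mul, sq_abs] at h
    linarith [h]
  -- the sum of squared deviations is `CP - 1/|T|`
  have hsum1 : ∑ v ∈ T, p v = 1 := sum_prob hS hT
  have hdev : ∑ v ∈ T, (p v - u) ^ 2 = collProb S g - u := by
    have h1 : ∑ v ∈ T, (p v - u) ^ 2 = ∑ v ∈ T, p v ^ 2 - 2 * u * ∑ v ∈ T, p v + T.card * u ^ 2 := by
      rw [Finset.mul_sum, ← Finset.sum_sub_distrib]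
      rw [show (T.card : ℝ) * u ^ 2 = ∑ _v ∈ T, u ^ 2 by rw [Finset.sum_const, nsmul_eq_mul], ← Finset.sum_add_distrib]
      exact Finset.sum_congr rfl fun v _ => by ring
    rw [h1, hsum1, ← collProb_eq_sum_sq hS hT, hu]
    field_simp
    ring
  have hbound : (∑ v ∈ T, |p v - u|) ^ 2 ≤ T.card * collProb S g - 1 := by
    calc (∑ v ∈ T, |p v - u|) ^ 2 ≤ T.card * ∑ v ∈ T, (p v - u) ^ 2 := hCS
      _ = T.card * collProb S g - 1 := by rw [hdev, hu, mul_sub, mul_one_div_cancel hN.ne']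
  have hsq : ∑ v ∈ T, |p v - u| ≤ Real.sqrt (T.card * collProb S g - 1) :=
    Real.le_sqrt_of_sq_le hbound
  unfold distUnif
  rw [← hp, ← hu]
  linarith [hsq]

/-! ### Re-indexing -/

omit [DecidableEq β] in
/-- Collision counts are invariant under an injective re-indexing of the source. [folklore] -/
theorem card_collisions_image [DecidableEq β] [DecidableEq ι] {W : Finset κ} {e : κ → ι} (he : Set.InjOn e W) (g : ι → β) :
    (((W.image e) ×ˢ (W.image e)).filter fun p => g p.1 = g p.2).card =
      ((W ×ˢ W).filter fun p => g (e p.1) = g (e p.2)).card := by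
  have hinj : Set.InjOn (fun p : κ × κ => (e p.1, e p.2)) ((W ×ˢ W).filter fun p => g (e p.1) = g (e p.2)) := by
    rintro ⟨a, b⟩ hab ⟨c, d⟩ hcd h
    simp only [Finset.coe_filter, Finset.mem_product, Set.mem_setOf_eq] at hab hcd
    simp only [Prod.mk.injEq] at h
    rw [he hab.1.1 hcd.1.1 h.1, he hab.1.2 hcd.1.2 h.2]
  rw [← Finset.card_image_of_injOn hinj]
  congr 1
  ext ⟨x, x'⟩
  simp only [Finset.mem_filter, Finset.mem_product, Finset.mem_image, Prod.mk.injEq]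
  constructor
  · rintro ⟨⟨⟨a, ha, rfl⟩, ⟨b, hb, rfl⟩⟩, hg⟩
    exact ⟨⟨a, b⟩, ⟨⟨ha, hb⟩, hg⟩, rfl, rfl⟩
  · rintro ⟨⟨a, b⟩, ⟨⟨ha, hb⟩, hg⟩, rfl, rfl⟩
    exact ⟨⟨⟨a, ha, rfl⟩, ⟨b, hb, rfl⟩⟩, hg⟩

omit [DecidableEq β] in
/-- `CP` is invariant under an injective re-indexing of the source. [folklore] -/
theorem collProb_image [DecidableEq β] [DecidableEq ι] {W : Finset κ} {e : κ → ι} (he : Set.InjOn e W) (g : ι → β) :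
    collProb (W.image e) g = collProb W (g ∘ e) := by
  unfold collProb
  rw [card_collisions_image he g, Finset.card_image_of_injOn he]
  rfl

omit [DecidableEq β] in
/-- Fibres under an injective re-indexing. [folklore] -/
theorem card_fib_image [DecidableEq β] [DecidableEq ι] {W : Finset κ} {e : κ → ι} (he : Set.InjOn e W) (g : ι → β) (v : β) :
    (fib (W.image e) g v).card = (fib W (g ∘ e) v).card := by
  unfold fib
  rw [Finset.filter_image, Finset.card_image_of_injOn (he.mono (fun x hx => (Finset.mem_filter.1 hx).1))]
  rfl

omit [DecidableEq β] in
/-- The distance from uniform is invariant under an injective re-indexing of the source. [folklore] -/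
theorem distUnif_image [DecidableEq β] [DecidableEq ι] {W : Finset κ} {e : κ → ι} (he : Set.InjOn e W) (g : ι → β) (T : Finset β) :
    distUnif (W.image e) g T = distUnif W (g ∘ e) T := by
  unfold distUnif prob
  simp_rw [card_fib_image he, Finset.card_image_of_injOn he]

/-! ### The Leftover Hash Lemma for flat sources and pairwise independent families -/

section LHL

variable {α γ : Type*} [DecidableEq γ] [Fintype γ]

/-- **Pairwise independence** of a finite family `(h_k)_{k ∈ K}` of functions `α → γ` on a set
`S`: for `x ≠ x'` in `S` and all `y, y'`, exactly `|K| / |γ|²` keys send `(x, x') ↦ (y, y')`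
(stated multiplied out). [Arora–Barak 2009, §8.2.2, Def. 8.14 (pairwise independent hash
functions)] [cite: AroraBarak2009, Def. 8.14] -/
def IsPairwiseIndep (K : Finset κ) (h : κ → α → γ) (S : Finset α) : Prop :=
  ∀ x ∈ S, ∀ x' ∈ S, x ≠ x' → ∀ y y' : γ,
    (K.filter fun k => h k x = y ∧ h k x' = y').card * Fintype.card γ ^ 2 = K.card

/-- Pairwise independence gives the collision probability `1/|γ|` for `x ≠ x'`:
`#{k : h_k x = h_k x'} · |γ| = |K|`. [Arora–Barak 2009, §8.2.2] [cite: AroraBarak2009, Lemma 21.26 (proof)] -/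
theorem IsPairwiseIndep.card_collide {K : Finset κ} {h : κ → α → γ} {S : Finset α} (hK : IsPairwiseIndep K h S)
    {x x' : α} (hx : x ∈ S) (hx' : x' ∈ S) (hne : x ≠ x') :
    (K.filter fun k => h k x = h k x').card * Fintype.card γ = K.card := by
  classical
  have hdecomp : (K.filter fun k => h k x = h k x').card = ∑ y : γ, (K.filter fun k => h k x = y ∧ h k x' = y).card := by
    rw [Finset.card_eq_sum_card_fiberwise (f := fun k => h k x) (t := Finset.univ) (fun _ _ => Finset.mem_univ _)]
    refine Finset.sum_congr rfl fun y _ => ?_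
    congr 1
    ext k
    simp only [Finset.mem_filter]
    constructor
    · rintro ⟨⟨hk, he⟩, hy⟩; exact ⟨hk, hy, he ▸ hy⟩
    · rintro ⟨hk, hy, hy'⟩; exact ⟨⟨hk, hy.trans hy'.symm⟩, hy⟩
  rcases isEmpty_or_nonempty γ with hγ | hγ
  · -- no values: `K` must be empty as well (vacuous family into an empty type is impossible unless `K = ∅`)
    have h0 : Fintype.card γ = 0 := Fintype.card_eq_zero
    have hKc : K.card = 0 := by
      by_contra hne0
      obtain ⟨k, hk⟩ := Finset.card_pos.1 (Nat.pos_of_ne_zero hne0)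
      exact hγ.elim (h k x)
    simp [hKc]
  · have hγpos : 0 < Fintype.card γ := Fintype.card_pos
    have hy : ∀ y : γ, (K.filter fun k => h k x = y ∧ h k x' = y).card * Fintype.card γ ^ 2 = K.card :=
      fun y => hK x hx x' hx' hne y y
    -- sum the `|γ|` equal fibre counts
    have hsum : (∑ y : γ, (K.filter fun k => h k x = y ∧ h k x' = y).card) * Fintype.card γ ^ 2 = Fintype.card γ * K.card := by
      rw [Finset.sum_mul, Finset.sum_congr rfl fun y _ => hy y, Finset.sum_const, Finset.card_univ, smul_eq_mul]
    rw [hdecomp]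
    have h2 : (∑ y : γ, (K.filter fun k => h k x = y ∧ h k x' = y).card) * Fintype.card γ * Fintype.card γ = K.card * Fintype.card γ := by
      rw [mul_assoc, ← sq, hsum, mul_comm]
    exact Nat.eq_of_mul_eq_mul_right hγpos h2

/-- The keyed map `(k, x) ↦ (k, h_k x)` on `K × S`. [folklore] -/
def keyed (h : κ → α → γ) (p : κ × α) : κ × γ := (p.1, h p.1 p.2)

/-- **Collision count of the keyed hash of a flat source**: for a pairwise independent family,
`#{((k,x),(k',x')) : (k, h_k x) = (k', h_{k'} x')} · |γ| ≤ |K| · |S| · (|γ| + |S|)`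
(`= |K| (|S| |γ| + |S|(|S|-1))` exactly). [Arora–Barak 2009, Lemma 21.26 (proof: "the probability
that `h = h'` times the probability that `h(x) = h(x')`")] [cite: AroraBarak2009, Lemma 21.26 (proof)] -/
theorem card_collisions_keyed_mul_le [DecidableEq κ] {K : Finset κ} {h : κ → α → γ} {S : Finset α} [DecidableEq α]
    (hK : IsPairwiseIndep K h S) :
    (((K ×ˢ S) ×ˢ (K ×ˢ S)).filter fun p => keyed h p.1 = keyed h p.2).card * Fintype.card γ ≤
      K.card * S.card * (Fintype.card γ + S.card) := by
  classical
  -- split the colliding pairs according to `x = x'` or not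
  set C := ((K ×ˢ S) ×ˢ (K ×ˢ S)).filter fun p => keyed h p.1 = keyed h p.2 with hC
  set Cdiag := C.filter fun p => p.1.2 = p.2.2 with hCd
  set Coff := C.filter fun p => p.1.2 ≠ p.2.2 with hCo
  have hsplit : C.card = Cdiag.card + Coff.card := by
    rw [hCd, hCo, ← Finset.card_filter_add_card_filter_not (p := fun p : (κ × α) × (κ × α) => p.1.2 = p.2.2)]
  -- diagonal: at most `|K| |S|` (determined by `(k, x)`)
  have hdiag : Cdiag.card ≤ K.card * S.card := by
    have hinj : Set.InjOn (fun p : (κ × α) × (κ × α) => p.1) Cdiag := by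
      intro p hp q hq heq
      have hp' := Finset.mem_filter.1 hp
      have hq' := Finset.mem_filter.1 hq
      have hk := congrArg Prod.fst (Finset.mem_filter.1 hp'.1).2
      have hl := congrArg Prod.fst (Finset.mem_filter.1 hq'.1).2
      dsimp only [keyed] at hk hl
      rcases p with ⟨⟨k, x⟩, ⟨k', x'⟩⟩
      rcases q with ⟨⟨l, y⟩, ⟨l', y'⟩⟩
      simp only [Prod.mk.injEq] at heq hk hl hp' hq' ⊢
      obtain ⟨rfl, rfl⟩ := heq
      exact ⟨⟨rfl, rfl⟩, hk.symm.trans hl, hp'.2.symm.trans hq'.2⟩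
    have hsub : Cdiag.image (fun p : (κ × α) × (κ × α) => p.1) ⊆ K ×ˢ S := by
      intro q hq
      obtain ⟨p, hp, rfl⟩ := Finset.mem_image.1 hq
      exact (Finset.mem_product.1 (Finset.mem_filter.1 (Finset.mem_filter.1 hp).1).1).1
    calc Cdiag.card = (Cdiag.image fun p => p.1).card := (Finset.card_image_of_injOn hinj).symm
      _ ≤ (K ×ˢ S).card := Finset.card_le_card hsub
      _ = K.card * S.card := Finset.card_product _ _
  -- off-diagonal: inject into triples `(k, x, x')` with `x ≠ x'`, `h_k x = h_k x'`, and count those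
  -- fibrewise over `(x, x')`: `|K|/|γ|` keys each, by pairwise independence
  have hoff : Coff.card * Fintype.card γ ≤ K.card * S.card * S.card := by
    set OD := (S ×ˢ S).filter fun q : α × α => q.1 ≠ q.2 with hOD
    set Z : Finset (κ × (α × α)) := (K ×ˢ OD).filter fun t => h t.1 t.2.1 = h t.1 t.2.2 with hZ
    have hinj : Set.InjOn (fun p : (κ × α) × (κ × α) => (p.1.1, (p.1.2, p.2.2))) Coff := by
      intro p hp q hq heq
      have hk := congrArg Prod.fst (Finset.mem_filter.1 (Finset.mem_filter.1 hp).1).2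
      have hl := congrArg Prod.fst (Finset.mem_filter.1 (Finset.mem_filter.1 hq).1).2
      dsimp only [keyed] at hk hl
      rcases p with ⟨⟨k, x⟩, ⟨k', x'⟩⟩
      rcases q with ⟨⟨l, y⟩, ⟨l', y'⟩⟩
      simp only [Prod.mk.injEq] at heq hk hl ⊢
      obtain ⟨rfl, rfl, rfl⟩ := heq
      exact ⟨⟨rfl, rfl⟩, hk.symm.trans hl, rfl⟩
    have himg : Coff.image (fun p : (κ × α) × (κ × α) => (p.1.1, (p.1.2, p.2.2))) ⊆ Z := by
      intro t ht
      obtain ⟨p, hp, rfl⟩ := Finset.mem_image.1 ht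
      have hp1 := Finset.mem_filter.1 hp
      have hp2 := Finset.mem_filter.1 hp1.1
      have hmem := Finset.mem_product.1 hp2.1
      have hk := congrArg Prod.fst hp2.2
      have hh := congrArg Prod.snd hp2.2
      dsimp only [keyed] at hk hh
      refine Finset.mem_filter.2 ⟨Finset.mem_product.2 ⟨(Finset.mem_product.1 hmem.1).1, ?_⟩, ?_⟩
      · exact Finset.mem_filter.2 ⟨Finset.mem_product.2 ⟨(Finset.mem_product.1 hmem.1).2, (Finset.mem_product.1 hmem.2).2⟩, hp1.2⟩
      · show h p.1.1 p.1.2 = h p.1.1 p.2.2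
        rw [hh, hk]
    have hfib : ∀ q ∈ OD, (Z.filter fun t => t.2 = q).card = (K.filter fun k => h k q.1 = h k q.2).card := by
      intro q hq
      rw [← Finset.card_image_of_injective (K.filter fun k => h k q.1 = h k q.2)
        (f := fun k : κ => (k, q)) (fun a b hab => (Prod.mk.inj hab).1)]
      congr 1
      ext ⟨k, q'⟩
      simp only [hZ, Finset.mem_filter, Finset.mem_product, Finset.mem_image, Prod.mk.injEq]
      constructor
      · rintro ⟨⟨⟨hk, _⟩, hh⟩, rfl⟩
        exact ⟨k, ⟨hk, hh⟩, rfl, rfl⟩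
      · rintro ⟨k₀, ⟨hk₀, hh⟩, rfl, rfl⟩
        exact ⟨⟨⟨hk₀, hq⟩, hh⟩, rfl⟩
    have hZcount : Z.card = ∑ q ∈ OD, (K.filter fun k => h k q.1 = h k q.2).card := by
      rw [Finset.card_eq_sum_card_fiberwise (f := fun t : κ × (α × α) => t.2) (t := OD)
        (fun t ht => (Finset.mem_product.1 (Finset.mem_filter.1 ht).1).2)]
      exact Finset.sum_congr rfl hfib
    have hZ' : Z.card * Fintype.card γ ≤ K.card * S.card * S.card := by
      calc Z.card * Fintype.card γ = ∑ q ∈ OD, (K.filter fun k => h k q.1 = h k q.2).card * Fintype.card γ := by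
            rw [hZcount, Finset.sum_mul]
        _ = ∑ _q ∈ OD, K.card := by
            refine Finset.sum_congr rfl fun q hq => ?_
            have hq' := Finset.mem_filter.1 hq
            have hqS := Finset.mem_product.1 hq'.1
            exact hK.card_collide hqS.1 hqS.2 hq'.2
        _ ≤ ∑ _q ∈ S ×ˢ S, K.card := Finset.sum_le_sum_of_subset_of_nonneg (Finset.filter_subset _ _) fun _ _ _ => Nat.zero_le _
        _ = K.card * S.card * S.card := by rw [Finset.sum_const, Finset.card_product, smul_eq_mul]; ring
    have hle : Coff.card ≤ Z.card :=
      (Finset.card_image_of_injOn hinj).symm.le.trans (Finset.card_le_card himg)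
    exact (Nat.mul_le_mul_right _ hle).trans hZ'
  calc C.card * Fintype.card γ = Cdiag.card * Fintype.card γ + Coff.card * Fintype.card γ := by rw [hsplit, add_mul]
    _ ≤ K.card * S.card * Fintype.card γ + K.card * S.card * S.card := add_le_add (Nat.mul_le_mul_right _ hdiag) hoff
    _ = K.card * S.card * (Fintype.card γ + S.card) := by ring

/-- **Leftover Hash Lemma, flat sources**: for a pairwise independent family `(h_k)_{k ∈ K}` into a
finite set `γ` and `X` uniform on `S ≠ ∅`,
`Δ((K, h_K(X)), U_{K × γ}) ≤ ½ √(|γ| / |S|)`.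
[Arora–Barak 2009, Lemma 21.26; Håstad–Impagliazzo–Levin–Luby 1999; Liu–Pass 2020, Appendix (LHL)]
[cite: AroraBarak2009, Lemma 21.26] -/
theorem leftoverHash_flat [DecidableEq κ] {K : Finset κ} (hKne : K.Nonempty) {h : κ → α → γ} {S : Finset α} [DecidableEq α] [Nonempty γ]
    (hS : S.Nonempty) (hK : IsPairwiseIndep K h S) :
    distUnif (K ×ˢ S) (keyed h) (K ×ˢ (Finset.univ : Finset γ)) ≤ 2⁻¹ * Real.sqrt (Fintype.card γ / S.card) := by
  classical
  have hKc : (0 : ℝ) < K.card := by exact_mod_cast hKne.card_pos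
  have hSc : (0 : ℝ) < S.card := by exact_mod_cast hS.card_pos
  have hγ : (0 : ℝ) < Fintype.card γ := by exact_mod_cast Fintype.card_pos
  have hmaps : ∀ p ∈ K ×ˢ S, keyed h p ∈ K ×ˢ (Finset.univ : Finset γ) := fun p hp =>
    Finset.mem_product.2 ⟨(Finset.mem_product.1 hp).1, Finset.mem_univ _⟩
  have hTne : (K ×ˢ (Finset.univ : Finset γ)).Nonempty := hKne.product Finset.univ_nonempty
  refine (distUnif_le_sqrt (hKne.product hS) hTne hmaps).trans ?_
  refine mul_le_mul_of_nonneg_left (Real.sqrt_le_sqrt ?_) (by norm_num)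
  -- `|T| · CP − 1 ≤ |γ|/|S|`
  have hcoll := card_collisions_keyed_mul_le hK
  have hcollR : ((((K ×ˢ S) ×ˢ (K ×ˢ S)).filter fun p => keyed h p.1 = keyed h p.2).card : ℝ) * Fintype.card γ ≤
      K.card * S.card * (Fintype.card γ + S.card) := by exact_mod_cast hcoll
  unfold collProb
  rw [Finset.card_product, Finset.card_product, Finset.card_univ, Nat.cast_mul, Nat.cast_mul]
  rw [sub_le_iff_le_add]
  have hKS : (0 : ℝ) < (K.card : ℝ) * S.card := mul_pos hKc hSc
  rw [show ((K.card : ℝ) * (Fintype.card γ : ℝ)) * ((((K ×ˢ S) ×ˢ (K ×ˢ S)).filter fun p => keyed h p.1 = keyed h p.2).card / ((K.card : ℝ) * S.card) ^ 2)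
      = ((((K ×ˢ S) ×ˢ (K ×ˢ S)).filter fun p => keyed h p.1 = keyed h p.2).card * Fintype.card γ) / (K.card * S.card * S.card) by
    field_simp]
  rw [div_le_iff₀ (by positivity)]
  calc ((((K ×ˢ S) ×ˢ (K ×ˢ S)).filter fun p => keyed h p.1 = keyed h p.2).card : ℝ) * Fintype.card γ
      ≤ K.card * S.card * (Fintype.card γ + S.card) := hcollR
    _ = (Fintype.card γ / S.card + 1) * (K.card * S.card * S.card) := by field_simp

/-- **Leftover Hash Lemma, printed form** (`SD ≤ 2^{-d/2}`): with `|S| ≥ 2ᵏ` (a flat source of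
min-entropy `≥ k`) and `|γ| ≤ 2^{k-d}` output values, `Δ((K, h_K(X)), U) ≤ 2^{-d/2}` (indeed
`≤ ½ · 2^{-d/2}`). [Liu–Pass 2020, Appendix, Leftover Hash Lemma [HILL99]; Arora–Barak 2009,
Lemma 21.26] [cite: LiuPassFOCS2020, Appendix (Leftover Hash Lemma)] -/
theorem leftoverHash_flat_two_pow [DecidableEq κ] {K : Finset κ} (hKne : K.Nonempty) {h : κ → α → γ} {S : Finset α} [DecidableEq α] [Nonempty γ]
    (hS : S.Nonempty) (hK : IsPairwiseIndep K h S) {k d : ℕ} (hdk : d ≤ k) (hSk : 2 ^ k ≤ S.card)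
    (hγ : Fintype.card γ ≤ 2 ^ (k - d)) :
    distUnif (K ×ˢ S) (keyed h) (K ×ˢ (Finset.univ : Finset γ)) ≤ (2 : ℝ) ^ (-(d : ℝ) / 2) := by
  refine (leftoverHash_flat hKne hS hK).trans ?_
  have hSc : (0 : ℝ) < S.card := by exact_mod_cast hS.card_pos
  have hratio : (Fintype.card γ : ℝ) / S.card ≤ (2 : ℝ) ^ (-(d : ℝ)) := by
    rw [div_le_iff₀ hSc]
    have h1 : (Fintype.card γ : ℝ) ≤ (2 : ℝ) ^ ((k : ℝ) - d) := by
      have : (Fintype.card γ : ℝ) ≤ (2 : ℝ) ^ (k - d) := by exact_mod_cast hγ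
      rwa [← Nat.cast_sub hdk, Real.rpow_natCast]
    have h2 : (2 : ℝ) ^ (k : ℝ) ≤ S.card := by
      have : ((2 : ℝ) ^ k) ≤ S.card := by exact_mod_cast hSk
      rwa [Real.rpow_natCast]
    calc (Fintype.card γ : ℝ) ≤ (2 : ℝ) ^ ((k : ℝ) - d) := h1
      _ = (2 : ℝ) ^ (-(d : ℝ)) * (2 : ℝ) ^ (k : ℝ) := by rw [← Real.rpow_add (by norm_num)]; ring_nf
      _ ≤ (2 : ℝ) ^ (-(d : ℝ)) * S.card := mul_le_mul_of_nonneg_left h2 (by positivity)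
  have hsqrt : Real.sqrt ((Fintype.card γ : ℝ) / S.card) ≤ (2 : ℝ) ^ (-(d : ℝ) / 2) := by
    rw [Real.sqrt_eq_rpow, show (-(d : ℝ) / 2) = (-(d : ℝ)) * (1 / 2) by ring, Real.rpow_mul (by norm_num)]
    exact Real.rpow_le_rpow (by positivity) hratio (by norm_num)
  have hpos : (0 : ℝ) ≤ (2 : ℝ) ^ (-(d : ℝ) / 2) := by positivity
  linarith

end LHL

end LeftoverHash

end Literature.Computability.Cryptography
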